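import Literature.AlgebraicTopology.Homotopy.SerreFibrationCellCap
import HarnessLib

/-!
# Serre fibrations over one cell: ONE identification `H_{k+s}(p⁻¹ē, p⁻¹ė) ≅ H_k(fibre)` commuting
# with the cap products by ALL degree-two classes

Topic `Literature/AlgebraicTopology/Homotopy`, sibling of `SerreFibrationCubeCap.lean` and
`SerreFibrationCellCap.lean` (E. H. Spanier, *Algebraic Topology* (1981), Ch. 9, Sec. 2,
Thm. 15 (a), in cap-product form: for a Serre fibration and a class `η ∈ H²(E; R)` there are
bijections `φ_k : H_{k+s}(p⁻¹ēⱼ, p⁻¹ėⱼ) → H_k(p⁻¹(Φⱼ0))` with `φ_k (η| ⌢ x) = η| ⌢ φ_{k+2} x`). Those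
files state the existence of `φ` AFTER fixing the class `η`; but the `φ` they construct — a
composite of maps of pairs, connecting maps of triples and (inverses of) maps induced by weak
equivalences — does not depend on `η`. Here the same inductions are re-run with the class
quantified INSIDE, giving one family `φ` that commutes with the cap product by every
`η ∈ H²(E; R)` simultaneously:

* `SerreCube.conj_cap_aux_forall`, `SerreCube.exists_conj_cap_forall` — over a cube;
* `SerreCell.exists_conj_cap_forall` — over one cell of a Hausdorff CW complex.

This uniformity is what a statement about SEVERAL classes needs: `SerreCell.relCapProduct_eq_zero_detect`
— if the `ζ_i|_F` jointly detect `H_{k+2}(F)` under the cap product (e.g. the `ζ_i|_F` span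
`H²(F)`, `k = 0`), then the `ζ_i|` jointly detect `H_{k+2+s}(p⁻¹ēⱼ, p⁻¹ėⱼ)` under the relative cap
product; summed over the `2`-cells this is the `E¹`-input `hZ` of the three-stage descent
`Filtration.eq_zero_of_capProduct_eq_zero_of_eHardLefschetz`
(`SingularHomology/FiltrationLefschetzCupGeneration.lean`; D. Arapura 2022, proof of Cor. 1.5,
"`[𝒵_1], …, [𝒵_N]` gives a basis of `R²f_*ℚ`"). Everything is proved; no definition and no named
fact is introduced (D-0026).

## References

* E. H. Spanier, *Algebraic Topology*, Springer (1981), Ch. 9, Sec. 2, Thm. 15 (a). [Spanier1981]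
* A. Hatcher, *Algebraic Topology*, CUP (2002), §3.3 pp. 239–241. [HatcherAT2002]
* C. Voisin, *Hodge Theory and Complex Algebraic Geometry II*, CUP (2003), Lemma 4.13, Thm. 4.15.
  [VoisinHodgeII2003]
* D. Arapura, *Hodge cycles and the Leray filtration*, Pacific J. Math. 319 (2022), proof of
  Cor. 1.5. [Arapura2022]
-/

noncomputable section

open Set Function Metric unitInterval CategoryTheory CategoryTheory.Limits
open scoped Topology unitInterval
open Literature.AlgebraicTopology.SingularHomology

namespace Literature.AlgebraicTopology.Homotopy

universe u v uR

/-! ### Over a cube -/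

namespace SerreCube

variable (R : Type uR) [CommRing R]

/-- **Cap-compatible identification `H_{k+d}(P, q⁻¹∂Iᵈ) ≅ H_k(P)`, uniformly in the class** (the
inductive statement, boundary preimage abstracted as `A`): ONE family of linear bijections `φ_k`
with `φ_k (θ ⌢ x) = θ ⌢ φ_{k+2} x` for EVERY `θ ∈ H²(P; R)`. Same induction on `d` as
`SerreCube.conj_cap_aux` (links `δ`, `ι`, the free-face fibration, `q⁻¹(face) ↪ P`), with `θ`
quantified inside. [cite: Spanier1981, Ch. 9, Sec. 2, Thm. 15 (a); VoisinHodgeII2003, Thm. 4.15 (proof)] -/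
theorem conj_cap_aux_forall : ∀ (d : ℕ) {P : Type u} [TopologicalSpace P] {q : P → (Fin d → I)}
    (_ : IsSerreFibration q) {A : Set P} (_ : A = q ⁻¹' Cube.boundary (Fin d)),
    ∃ φ : ∀ k, relativeSingularHomology R R P A (k + d) →ₗ[R] singularHomology R R P k,
      (∀ k, Function.Bijective (φ k)) ∧
      ∀ (θ : singularCohomology R R P 2) (k : ℕ) (x : relativeSingularHomology R R P A (k + 2 + d)),
        φ k (relCapProduct A (show 2 + (k + d) = k + 2 + d by omega) θ x) =
          capProduct (show 2 + k = k + 2 by omega) θ (φ (k + 2) x) := by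
  intro d
  induction d with
  | zero =>
    intro P _ q hq A hA
    subst hA
    haveI : IsEmpty ↥(q ⁻¹' Cube.boundary (Fin 0)) := ⟨fun z => by
      obtain ⟨i, -⟩ := (z.2 : q z.1 ∈ Cube.boundary (Fin 0)); exact i.elim0⟩
    haveI := fun k => relativeSingularHomology.isIso_ofAbsolute_of_isEmpty R R (X := P)
      (q ⁻¹' Cube.boundary (Fin 0)) k
    let e : ∀ k, singularHomology R R P k ≃ₗ[R]
        relativeSingularHomology R R P (q ⁻¹' Cube.boundary (Fin 0)) k := fun k =>
      (asIso (relativeSingularHomology.ofAbsolute R R P (q ⁻¹' Cube.boundary (Fin 0)) k)).toLinearEquiv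
    have he : ∀ k (c : singularHomology R R P k),
        e k c = relativeSingularHomology.ofAbsolute R R P (q ⁻¹' Cube.boundary (Fin 0)) k c :=
      fun k c => rfl
    refine ⟨fun k => (e k).symm.toLinearMap, fun k => (e k).symm.bijective, fun θ k x => ?_⟩
    apply (e k).injective
    change e k ((e k).symm _) = e k (capProduct _ θ ((e (k + 2)).symm x))
    rw [LinearEquiv.apply_symm_apply, he, ← relCapProduct_ofAbsolute, ← he,
      LinearEquiv.apply_symm_apply]
  | succ m ih =>
    intro P _ q hq A hA
    subst hA
    -- the four links
    haveI := fun n => isIso_tripleδ R hq n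
    haveI := fun n => isIso_ι R hq n
    obtain ⟨φF, hφF, hcommF⟩ := ih (isSerreFibration_faceMap hq) faceMap_preimage_boundary.symm
    haveI := fun k => isIso_singularHomology_map_of_isWeakHomotopyEquiv (R := R) (faceVal q)
      (isWeakHomotopyEquiv_faceVal hq) k
    let eδ : ∀ n, relativeSingularHomology R R P (bdP q) (n + 1) ≃ₗ[R]
        relativeSingularHomology R R ↥(bdP q) (Subtype.val ⁻¹' jbP q) n := fun n =>
      (asIso (relativeSingularHomology.tripleδ R R P (bdP q) (jbP q) n)).toLinearEquiv
    have heδ : ∀ n x, eδ n x = relativeSingularHomology.tripleδ R R P (bdP q) (jbP q) n x :=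
      fun n x => rfl
    let eι : ∀ n, relativeSingularHomology R R (FaceP q) (Subtype.val ⁻¹' (q ⁻¹' jb m)) n ≃ₗ[R]
        relativeSingularHomology R R ↥(bdP q) (Subtype.val ⁻¹' jbP q) n := fun n =>
      (asIso (relativeSingularHomology.map R R (faceIncl q) (mapsTo_faceIncl (q := q)) n)).toLinearEquiv
    have heι : ∀ n y, eι n y =
        relativeSingularHomology.map R R (faceIncl q) (mapsTo_faceIncl (q := q)) n y :=
      fun n y => rfl
    let eV : ∀ k, singularHomology R R (FaceP q) k ≃ₗ[R] singularHomology R R P k := fun k =>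
      (asIso (singularHomology.map R R (faceVal q) k)).toLinearEquiv
    have heV : ∀ k c, eV k c = singularHomology.map R R (faceVal q) k c := fun k c => rfl
    refine ⟨fun k => (eV k).toLinearMap ∘ₗ φF k ∘ₗ (eι (k + m)).symm.toLinearMap ∘ₗ
      (eδ (k + m)).toLinearMap, fun k => ?_, fun θ k x => ?_⟩
    · exact (eV k).bijective.comp ((hφF k).comp ((eι (k + m)).symm.bijective.comp (eδ (k + m)).bijective))
    · -- the chain of commutations
      change eV k (φF k ((eι (k + m)).symm (eδ (k + m) (relCapProduct (bdP q) _ θ x)))) =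
        capProduct _ θ (eV (k + 2) (φF (k + 2) ((eι (k + 2 + m)).symm (eδ (k + 2 + m) x))))
      -- (1) `δ`
      have h1 : eδ (k + m) (relCapProduct (bdP q)
            (show 2 + (k + (m + 1)) = k + 2 + (m + 1) by omega) θ x) =
          relCapProduct (Subtype.val ⁻¹' jbP q) (show 2 + (k + m) = k + 2 + m by omega)
            (singularCohomology.map R R
              (⟨Subtype.val, continuous_subtype_val⟩ : C(↥(bdP q), P)) 2 θ)
            (eδ (k + 2 + m) x) := by
        rw [heδ, heδ]
        exact tripleδ_relCapProduct_two R θ (k + m) (k + 2 + m) (by omega) x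
      -- (2) `ι⁻¹`
      have h2 : ∀ w, (eι (k + m)).symm (relCapProduct (Subtype.val ⁻¹' jbP q)
            (show 2 + (k + m) = k + 2 + m by omega) (singularCohomology.map R R
              (⟨Subtype.val, continuous_subtype_val⟩ : C(↥(bdP q), P)) 2 θ) w) =
          relCapProduct (Subtype.val ⁻¹' (q ⁻¹' jb m)) (show 2 + (k + m) = k + 2 + m by omega)
            (singularCohomology.map R R (faceVal q) 2 θ) ((eι (k + 2 + m)).symm w) := fun w => by
        apply (eι (k + m)).injective
        rw [LinearEquiv.apply_symm_apply, heι, map_faceIncl_relCapProduct_two, ← heι,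
          LinearEquiv.apply_symm_apply]
      -- (3) the face, uniformly in the class, (4) `faceVal`
      rw [h1, h2, hcommF (singularCohomology.map R R (faceVal q) 2 θ) k, heV,
        map_faceVal_capProduct_two R θ k (k + 2) (by omega), ← heV]

variable {d : ℕ} {P : Type u} [TopologicalSpace P] {q : P → (Fin d → I)}

/-- **Spanier's Thm. 9.2.15 (a) over a cube, cap-product form, uniformly in the class.** For a
Serre fibration `q : P → Iᵈ` there are `R`-linear bijections
`φ_k : H_{k+d}(P, q⁻¹∂Iᵈ; R) → H_k(P; R)` with `φ_k (θ ⌢ x) = θ ⌢ φ_{k+2} x` for EVERY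
`θ ∈ H²(P; R)`. [cite: Spanier1981, Ch. 9, Sec. 2, Thm. 15 (a); VoisinHodgeII2003, Thm. 4.15 (proof)] -/
theorem exists_conj_cap_forall (hq : IsSerreFibration q) :
    ∃ φ : ∀ k, relativeSingularHomology R R P (q ⁻¹' Cube.boundary (Fin d)) (k + d) →ₗ[R]
        singularHomology R R P k,
      (∀ k, Function.Bijective (φ k)) ∧
      ∀ (θ : singularCohomology R R P 2) (k : ℕ)
        (x : relativeSingularHomology R R P (q ⁻¹' Cube.boundary (Fin d)) (k + 2 + d)),
        φ k (relCapProduct (q ⁻¹' Cube.boundary (Fin d)) (show 2 + (k + d) = k + 2 + d by omega) θ x) =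
          capProduct (show 2 + k = k + 2 by omega) θ (φ (k + 2) x) :=
  conj_cap_aux_forall R d hq rfl

end SerreCube

/-! ### Over one cell of a CW complex -/

namespace SerreCell

open _root_.Topology RelCWComplex SkeletonCollar CellsDirectSum

variable {X : Type v} [TopologicalSpace X] [T2Space X] [CWComplex (univ : Set X)] {s : ℕ}
variable (R : Type uR) [CommRing R]
variable {E : Type u} [TopologicalSpace E] {p : E → X} (j : cell (univ : Set X) s)

/-- **Spanier's Thm. 9.2.15 (a) over one cell, cap-product form, uniformly in the class.** For a
Serre fibration `p : E → X` over a Hausdorff CW complex and an `s`-cell `eⱼ`, there are `R`-linear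
bijections `φ_k : H_{k+s}(p⁻¹ēⱼ, p⁻¹ėⱼ; R) → H_k(p⁻¹(Φⱼ0); R)` with
`φ_k (η|_{p⁻¹ēⱼ} ⌢ x) = η|_{p⁻¹(Φⱼ0)} ⌢ φ_{k+2} x` for EVERY `η ∈ H²(E; R)` (same chain as
`SerreCell.exists_conj_cap`: `isIso_b`, the projection of pairs from the pull-back `Q`, the cube,
and the weak equivalence `p⁻¹(Φⱼ0) ↪ Q`).
[cite: Spanier1981, Ch. 9, Sec. 2, Thm. 15 (a); VoisinHodgeII2003, Thm. 4.15 (proof)] -/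
theorem exists_conj_cap_forall (hp : IsSerreFibration p) :
    ∃ φ : ∀ k, relativeSingularHomology R R (Cl p j) (fr p j) (k + s) →ₗ[R]
        singularHomology R R ↥(p ⁻¹' {map s j 0}) k,
      (∀ k, Function.Bijective (φ k)) ∧
      ∀ (η : singularCohomology R R E 2) (k : ℕ)
        (x : relativeSingularHomology R R (Cl p j) (fr p j) (k + 2 + s)),
        φ k (relCapProduct (fr p j) (show 2 + (k + s) = k + 2 + s by omega)
            (singularCohomology.map R R (subsetIncl (p ⁻¹' closedCell s j)) 2 η) x) =
          capProduct (show 2 + k = k + 2 by omega)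
            (singularCohomology.map R R (subsetIncl (p ⁻¹' {map s j 0})) 2 η) (φ (k + 2) x) := by
  -- (1) `(Cl, fr) → (Cl, an)` along `b`
  haveI := fun n => Serre.isIso_b R hp j n
  let eb : ∀ n, relativeSingularHomology R R (Cl p j) (fr p j) n ≃ₗ[R]
      relativeSingularHomology R R (Cl p j) (an p j) n := fun n =>
    (asIso (relativeSingularHomology.map R R (ContinuousMap.id (Cl p j))
      (mapsTo_id_of_subset (fr_subset_an j)) n)).toLinearEquiv
  have heb : ∀ n x, eb n x = relativeSingularHomology.map R R (ContinuousMap.id (Cl p j))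
      (mapsTo_id_of_subset (fr_subset_an j)) n x := fun n x => rfl
  -- (2) `(Q, QS) → (Cl, an)` along `Π`
  haveI := fun n => isIso_map_proj j hp R n
  let eP : ∀ n, relativeSingularHomology R R (Q p j) (QS p j) n ≃ₗ[R]
      relativeSingularHomology R R (Cl p j) (an p j) n := fun n =>
    (asIso (relativeSingularHomology.map R R (proj p j) (mapsTo_proj_QS (p := p) j) n)).toLinearEquiv
  have heP : ∀ n x, eP n x = relativeSingularHomology.map R R (proj p j)
      (mapsTo_proj_QS (p := p) j) n x := fun n x => rfl
  -- (3) the cube theorem for `Q → Iˢ`, uniformly in the class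
  obtain ⟨φQ, hφQ, hcommQ⟩ := SerreCube.conj_cap_aux_forall R s (isSerreFibration_qmap j hp)
    (qmap_preimage_boundary (p := p) j).symm
  -- (4) the fibre over the centre includes into `Q` by a weak equivalence
  haveI := fun k => isIso_singularHomology_map_of_isWeakHomotopyEquiv (R := R) (fibreIncl p j)
    (isWeakHomotopyEquiv_fibreIncl j hp) k
  let eF : ∀ k, singularHomology R R ↥(p ⁻¹' {map s j 0}) k ≃ₗ[R] singularHomology R R (Q p j) k :=
    fun k => (asIso (singularHomology.map R R (fibreIncl p j) k)).toLinearEquiv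
  have heF : ∀ k c, eF k c = singularHomology.map R R (fibreIncl p j) k c := fun k c => rfl
  refine ⟨fun k => (eF k).symm.toLinearMap ∘ₗ φQ k ∘ₗ (eP (k + s)).symm.toLinearMap ∘ₗ
    (eb (k + s)).toLinearMap, fun k => ?_, fun η k x => ?_⟩
  · exact (eF k).symm.bijective.comp ((hφQ k).comp ((eP (k + s)).symm.bijective.comp (eb (k + s)).bijective))
  · -- notation for the classes
    set θ := singularCohomology.map R R (subsetIncl (p ⁻¹' closedCell s j)) 2 η with hθ
    set θQ := singularCohomology.map R R (proj p j) 2 θ with hθQ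
    have hθF : singularCohomology.map R R (fibreIncl p j) 2 θQ =
        singularCohomology.map R R (subsetIncl (p ⁻¹' {map s j 0})) 2 η :=
      map_fibreIncl_map_proj_restrict R j η
    change (eF k).symm (φQ k ((eP (k + s)).symm (eb (k + s) (relCapProduct (fr p j) _ θ x)))) =
      capProduct _ (singularCohomology.map R R (subsetIncl (p ⁻¹' {map s j 0})) 2 η)
        ((eF (k + 2)).symm (φQ (k + 2) ((eP (k + 2 + s)).symm (eb (k + 2 + s) x))))
    -- (1) `b`
    have h1 : eb (k + s) (relCapProduct (fr p j) (show 2 + (k + s) = k + 2 + s by omega) θ x) =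
        relCapProduct (an p j) (show 2 + (k + s) = k + 2 + s by omega) θ (eb (k + 2 + s) x) := by
      rw [heb, heb, ← relativeSingularHomology.map_relCapProduct, singularCohomology.map_id]
      rfl
    -- (2) `Π⁻¹`
    have h2 : ∀ w, (eP (k + s)).symm (relCapProduct (an p j)
        (show 2 + (k + s) = k + 2 + s by omega) θ w) =
        relCapProduct (QS p j) (show 2 + (k + s) = k + 2 + s by omega) θQ ((eP (k + 2 + s)).symm w) :=
      fun w => by
      apply (eP (k + s)).injective
      rw [LinearEquiv.apply_symm_apply, heP, relativeSingularHomology.map_relCapProduct, ← heP,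
        LinearEquiv.apply_symm_apply]
    -- (4) `fibreIncl⁻¹`
    have h4 : ∀ c, (eF k).symm (capProduct (show 2 + k = k + 2 by omega) θQ c) =
        capProduct (show 2 + k = k + 2 by omega)
          (singularCohomology.map R R (subsetIncl (p ⁻¹' {map s j 0})) 2 η) ((eF (k + 2)).symm c) :=
      fun c => by
      apply (eF k).injective
      rw [LinearEquiv.apply_symm_apply, heF, ← hθF, capProduct_map, ← heF, LinearEquiv.apply_symm_apply]
    rw [h1, h2, hcommQ θQ k, h4]

/-- **Joint cap-detection transfers from the fibre to the piece over a cell.** If classes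
`ζ_i ∈ H²(E; R)` restricted to the fibre `F = p⁻¹(Φⱼ0)` jointly detect `H_{k+2}(F; R)` under the
cap product (`∀ i, ζ_i|_F ⌢ y = 0 ⇒ y = 0`), then their restrictions to `p⁻¹ēⱼ` jointly detect
`H_{k+2+s}(p⁻¹ēⱼ, p⁻¹ėⱼ; R)` under the relative cap product (through the uniform identification
`exists_conj_cap_forall`). For `k = 0`, `s = 2` and a bundle of compact Kähler surfaces this is
"the `[𝒵_i]|_F` span `H²(F)`" ⇒ detection of `E¹_{2,4}`, the input `hZ` of the three-stage
descent of `FiltrationLefschetzCupGeneration.lean`. [cite: Spanier1981, Ch. 9, Sec. 2, Thm. 15 (a)]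
[cite: Arapura2022, proof of Cor. 1.5 (p. 5)] -/
theorem relCapProduct_eq_zero_detect (hp : IsSerreFibration p) {ι : Type*}
    (ζ : ι → singularCohomology R R E 2) (k : ℕ)
    (hdet : ∀ y : singularHomology R R ↥(p ⁻¹' {map s j 0}) (k + 2),
      (∀ i, capProduct (show 2 + k = k + 2 by omega)
        (singularCohomology.map R R (subsetIncl (p ⁻¹' {map s j 0})) 2 (ζ i)) y = 0) → y = 0)
    (x : relativeSingularHomology R R (Cl p j) (fr p j) (k + 2 + s))
    (hx : ∀ i, relCapProduct (fr p j) (show 2 + (k + s) = k + 2 + s by omega)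
      (singularCohomology.map R R (subsetIncl (p ⁻¹' closedCell s j)) 2 (ζ i)) x = 0) :
    x = 0 := by
  obtain ⟨φ, hφ, hcomm⟩ := exists_conj_cap_forall R j hp
  refine (hφ (k + 2)).1 ?_
  rw [map_zero]
  refine hdet _ fun i => ?_
  rw [← hcomm (ζ i) k x, hx i, map_zero]

end SerreCell

end Literature.AlgebraicTopology.Homotopy

end
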